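import Summits.NavierStokesRegularity.FluidComputer.PalasekTowerPerturbedRun
import Literature.Analysis.FluidPDE.ClassicalBoundedUniformDerivativeBounds
import Literature.Analysis.FluidPDE.ClassicalShortTimeSupBound
import Literature.Analysis.FluidPDE.IsometryInvariance

/-!
# THE PERTURBED RUN, III: a UNIFORM bound on the second derivatives of the run at the final time,
# when the force has switched off — and the gradient of the perturbed run is close to the gradient
# of the free run there

Cell `ns-blowup`, seat `ns-blowup-ecbridge-3` (g6; D-0074 GROUP C «BRIDGE SUPPORT», lineage
`host_preparation`; bears_on LADDER-NS N1, route `PalasekTowerBreakdown`, crux `EpisodeBase` = item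
stmt-NavierStokesRegularity-19179, line `slot` v5, stub `stub_explicit_slice_run : ExplicitSliceRun`).
LABEL: E–C typing + kernel analysis (theorems only; no definition, no named fact, no `sorry`).
WHAT THIS IS NOT: not Navier–Stokes evidence — derivative bookkeeping for GIVEN classical solutions
on a FIXED slab; no stage, host, episode or blow-up is constructed or asserted.

## What is proved (`ν = 1`)

* `PerturbedRun.exists_uniform_final_iteratedFDeriv_two_bound` — for all `M > 0`, `T > 0` there is
  `K` such that EVERY classical finite-energy solution `(u', p')` on `[0, T] × ℝ³` of the system
  forced by a Clay-class force VANISHING from `T/2` on, with Schwartz datum and `‖u'‖ ≤ M + 1/2`,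
  has `‖D²u'(T, x)‖ ≤ K` for all `x`. Mechanism: continue `u'` classically past `T`
  (`ForcedContinuation.exists_continuation_of_bounded`); after `T/2` the flow is UNFORCED, and
  Leray's short-time bound (`exists_norm_le_two_mul_of_finiteEnergy_from`) keeps it below `2M + 1`
  for a while after `T`; on a window of the FIXED length `T/2` containing `T` in its interior, KNSS
  (4.10) with constants first (`exists_uniform_iteratedFDeriv_bound_of_bounded_classical`) bounds
  `D²u'(T)` by a constant depending on `(M, T)` only.
* `PerturbedRun.norm_fderiv_sub_le_final` — **gradient closeness at the final time**: for the free
  run `u` (`‖u‖ ≤ M`) and such a perturbed run `u'` with `‖u' − u‖ ≤ Φ` on the slab,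
  `‖Du'(T,x) − Du(T,x)‖ ≤ 2Φ/h + (K + K_u) h` for every `h > 0` (`K_u` a bound of `‖D²u(T,·)‖`;
  Landau's inequality `norm_fderiv_le_of_norm_le_of_norm_iteratedFDeriv_two_le`).

References: G. Koch, N. Nadirashvili, G. Seregin, V. Šverák, Acta Math. 203 (2009), §4 (4.10)
[cite: KochNadirashviliSereginSverak2009, §4 (4.10)]; J. Leray, Acta Math. 63 (1934), §21 (3.15)
[cite: Leray1934, §21 (3.15) p. 226]; T. Tao, Anal. PDE 6 (2013), Thm. 5.4 [cite: Tao2011, Thm. 5.4 (ii)+(iv)];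
S. Palasek, arXiv:2605.13827 §4 [cite: Palasek2026ElementaryModel, §4].
-/

noncomputable section

namespace Summit.NavierStokesRegularity.FluidComputer.PalasekTowerClayBridge.PerturbedRun

open Set MeasureTheory Filter Topology Function Real
open scoped ENNReal NNReal ContDiff
open Literature.Analysis.FluidPDE

section FinalTime

/-- **A uniform bound on `D²u'(T)` for perturbed runs whose force has switched off from `T/2` on.**
For all `M > 0`, `T > 0` there is `K` such that every classical finite-energy solution `(u', p')` of
the Navier–Stokes system (`ν = 1`) on `[0, T] × ℝ³`, forced by a Clay-class `f` with `f(t, ·) = 0`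
for `t ≥ T/2`, with Schwartz datum `u' 0` and `‖u'‖ ≤ M + 1/2` on the slab, satisfies
`‖D²u'(T, x)‖ ≤ K` for all `x`. [cite: KochNadirashviliSereginSverak2009, §4 (4.10)]
[cite: Leray1934, §21 (3.15) p. 226] [cite: Tao2011, Thm. 5.4 (ii)+(iv)] -/
theorem exists_uniform_final_iteratedFDeriv_two_bound (M T : ℝ) (hM : 0 < M) (hT : 0 < T) :
    ∃ K : ℝ, ∀ {f u' : ℝ → EuclideanSpace ℝ (Fin 3) → EuclideanSpace ℝ (Fin 3)}
      {p' : ℝ → EuclideanSpace ℝ (Fin 3) → ℝ},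
      IsSmoothOnHalfSpace f → HasRapidSpaceTimeDecay f → (∀ t, T / 2 ≤ t → ∀ x, f t x = 0) →
      IsClassicalNSSolutionOn (Icc 0 T) 1 f u' p' →
      (∃ C : ℝ≥0∞, C < ⊤ ∧ ∀ t ∈ Icc 0 T, ∫⁻ x, ‖u' t x‖ₑ ^ 2 ≤ C) →
      HasRapidSpatialDecay (u' 0) → (∀ t ∈ Icc 0 T, ∀ x, ‖u' t x‖ ≤ M + 1 / 2) →
      ∀ x, ‖iteratedFDeriv ℝ 2 (u' T) x‖ ≤ K := by
  obtain ⟨c₀, hc₀, hdouble⟩ := exists_norm_le_two_mul_of_finiteEnergy_from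
  set A : ℝ := M + 1 / 2 with hA
  have hA0 : 0 < A := by positivity
  set N : ℝ := 2 * A with hN
  have hN0 : 0 < N := by positivity
  have hT2 : 0 < T / 2 := by positivity
  obtain ⟨C, hC⟩ := exists_uniform_iteratedFDeriv_bound_of_bounded_classical N (T / 2) hT2
  refine ⟨C 2 (T / 8), ?_⟩
  intro f u' p' hs hd hzero hcl' hE' h0 hbd' x
  -- ### continue `u'` classically past `T`
  obtain ⟨T'', hT'', U, P, hU, hUeq, hUE⟩ :=
    ForcedContinuation.exists_continuation_of_bounded one_pos hT hs hd hcl' hE' hbd' h0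
  have hUT : U T = u' T := (hUeq T ⟨hT.le, le_rfl⟩).1
  -- ### the flow from `T/2` on is unforced: `V r = U (r + T/2)` on `[0, T'' − T/2]`
  have hL : 0 < T'' - T / 2 := by linarith
  have hV : IsClassicalNSSolutionOn (Icc 0 (T'' - T / 2)) 1 0 (fun r => U (r + T / 2))
      (fun r => P (r + T / 2)) := by
    have h1 : IsClassicalNSSolutionOn (Icc 0 (T'' - T / 2)) 1 (fun r => f (r + T / 2))
        (fun r => U (r + T / 2)) (fun r => P (r + T / 2)) :=
      (hU.comp_add_right (T / 2)).mono (fun r hr => ⟨by linarith [hr.1], by linarith [hr.2]⟩)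
        (uniqueDiffOn_Icc hL)
    exact h1.congr_force fun r hr y => by
      show f (r + T / 2) y = (0 : ℝ → EuclideanSpace ℝ (Fin 3) → EuclideanSpace ℝ (Fin 3)) r y
      rw [hzero (r + T / 2) (by linarith [hr.1]) y]; rfl
  have hVE : ∃ Cv : ℝ≥0∞, Cv < ⊤ ∧ ∀ r ∈ Icc 0 (T'' - T / 2), ∫⁻ y, ‖U (r + T / 2) y‖ₑ ^ 2 ≤ Cv := by
    obtain ⟨Cv, hCv, hb⟩ := hUE
    exact ⟨Cv, hCv, fun r hr => hb (r + T / 2) ⟨by linarith [hr.1], by linarith [hr.2]⟩⟩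
  -- ### Leray's bound from the time `T/2` of `V` (= time `T` of `U`): `‖V‖ ≤ 2A` shortly after
  have hVA : ∀ y, ‖U (T / 2 + T / 2) y‖ ≤ A := fun y => by
    rw [add_halves, hUT]; exact hbd' T ⟨hT.le, le_rfl⟩ y
  have hlate : ∀ r ∈ Icc (T / 2) (T'' - T / 2), r - T / 2 < c₀ * 1 / A ^ 2 → ∀ y,
      ‖U (r + T / 2) y‖ ≤ 2 * A := fun r hr hrw y =>
    hdouble one_pos hT2.le (by linarith) hV hVE hA0 hVA r hr hrw y
  -- ### the window of length `T/2` starting at `δ₁`, containing the time `T/2` (= `T` of `U`)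
  set δ₁ : ℝ := min (c₀ / (2 * A ^ 2)) (min ((T'' - T) / 2) (T / 16)) with hδ₁
  have hδ₁pos : 0 < δ₁ := lt_min (by positivity) (lt_min (by linarith) (by positivity))
  have hδ₁c : δ₁ ≤ c₀ / (2 * A ^ 2) := min_le_left _ _
  have hδ₁T'' : δ₁ ≤ (T'' - T) / 2 := (min_le_right _ _).trans (min_le_left _ _)
  have hδ₁T : δ₁ ≤ T / 16 := (min_le_right _ _).trans (min_le_right _ _)
  have hV₁ : IsClassicalNSSolutionOn (Icc 0 (T / 2)) 1 0 (fun r => U (r + δ₁ + T / 2))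
      (fun r => P (r + δ₁ + T / 2)) := by
    have h1 := (hV.comp_add_right δ₁).mono (S' := Icc 0 (T / 2))
      (fun r hr => ⟨by linarith [hr.1], by linarith [hr.2]⟩) (uniqueDiffOn_Icc hT2)
    exact h1
  have hV₁E : ∃ Cv : ℝ≥0∞, Cv < ⊤ ∧ ∀ r ∈ Icc 0 (T / 2), ∫⁻ y, ‖U (r + δ₁ + T / 2) y‖ₑ ^ 2 ≤ Cv := by
    obtain ⟨Cv, hCv, hb⟩ := hVE
    exact ⟨Cv, hCv, fun r hr => hb (r + δ₁) ⟨by linarith [hr.1], by linarith [hr.2]⟩⟩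
  have hV₁N : ∀ r ∈ Icc 0 (T / 2), ∀ y, ‖U (r + δ₁ + T / 2) y‖ ≤ N := by
    intro r hr y
    by_cases hrT : r + δ₁ ≤ T / 2
    · -- before the original time `T`: the bound `M + 1/2`
      have hmem : r + δ₁ + T / 2 ∈ Icc 0 T := ⟨by linarith [hr.1], by linarith⟩
      rw [(hUeq _ hmem).1]
      exact (hbd' _ hmem y).trans (by rw [hN]; linarith)
    · -- after `T`: Leray's bound
      rw [not_le] at hrT
      have h1 := hlate (r + δ₁) ⟨hrT.le, by linarith [hr.2]⟩ ?_ y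
      · simpa [add_assoc] using h1
      · have : r + δ₁ - T / 2 ≤ δ₁ := by linarith [hr.2]
        have h2 : c₀ / (2 * A ^ 2) < c₀ * 1 / A ^ 2 := by
          rw [mul_one, div_lt_div_iff₀ (by positivity) (by positivity)]
          nlinarith [mul_pos hc₀ (pow_pos hA0 2)]
        linarith
  -- ### KNSS (4.10) on the window, at the interior time `T/2 − δ₁`
  have htI : T / 2 - δ₁ ∈ Ioo (T / 8) (T / 2) := ⟨by linarith, by linarith⟩
  have hk := hC hV₁ hV₁E hN0 hV₁N (T / 8) (by positivity) 2 (T / 2 - δ₁) htI x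
  have heq : U (T / 2 - δ₁ + δ₁ + T / 2) = u' T := by
    rw [sub_add_cancel, add_halves, hUT]
  have hk' : ‖iteratedFDeriv ℝ 2 (U (T / 2 - δ₁ + δ₁ + T / 2)) x‖ ≤ C 2 (T / 8) := by
    simpa using hk
  rwa [heq] at hk'

/-- **Gradient closeness at the final time** (Landau's inequality): if `‖u'(t,x) − u(t,x)‖ ≤ Φ` on
the slab and `‖D²u'(T, ·)‖ ≤ K`, `‖D²u(T, ·)‖ ≤ K_u`, then for every `h > 0` and `x`,
`‖Du'(T, x) − Du(T, x)‖ ≤ 2Φ/h + (K + K_u) h`. [cite: HardyLittlewoodPolya1952, §8 (Landau's inequality)] -/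
theorem norm_fderiv_sub_le_final {T Φ K Ku h : ℝ}
    {u u' : ℝ → EuclideanSpace ℝ (Fin 3) → EuclideanSpace ℝ (Fin 3)}
    (hu : ContDiff ℝ 2 (u T)) (hu' : ContDiff ℝ 2 (u' T))
    (hΦ : ∀ x, ‖u' T x - u T x‖ ≤ Φ) (hK : ∀ x, ‖iteratedFDeriv ℝ 2 (u' T) x‖ ≤ K)
    (hKu : ∀ x, ‖iteratedFDeriv ℝ 2 (u T) x‖ ≤ Ku) (hh : 0 < h) (x : EuclideanSpace ℝ (Fin 3)) :
    ‖fderiv ℝ (u' T) x - fderiv ℝ (u T) x‖ ≤ 2 * Φ / h + (K + Ku) * h := by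
  have hd' : DifferentiableAt ℝ (u' T) x := (hu'.differentiable (by norm_num)) x
  have hd : DifferentiableAt ℝ (u T) x := (hu.differentiable (by norm_num)) x
  rw [← fderiv_sub hd' hd]
  refine norm_fderiv_le_of_norm_le_of_norm_iteratedFDeriv_two_le (f := fun y => u' T y - u T y)
    (hu'.sub hu) hΦ (fun z => ?_) hh x
  have h2 : iteratedFDeriv ℝ 2 (fun y => u' T y - u T y) z =
      iteratedFDeriv ℝ 2 (u' T) z - iteratedFDeriv ℝ 2 (u T) z := by
    have := iteratedFDeriv_sub_apply (𝕜 := ℝ) (f := u' T) (g := u T) (i := 2)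
      (hu'.contDiffAt.of_le le_rfl) (hu.contDiffAt.of_le le_rfl) (x := z)
    exact this
  rw [h2]
  exact (norm_sub_le _ _).trans (add_le_add (hK z) (hKu z))

end FinalTime

end Summit.NavierStokesRegularity.FluidComputer.PalasekTowerClayBridge.PerturbedRun

end
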